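import Mathlib
import Literature.Analysis.FluidPDE.Tao2016AveragedNS.ShiftSetCascadeFlows
import Literature.Analysis.FluidPDE.Tao2016AveragedNS.ShiftSetCascadeFlux
import Summits.NavierStokesRegularity.NavierStokesRegularity.Theorems.TaoLadderRungTwoFlatCertificateGlueCheckerVectorOn
import Summits.NavierStokesRegularity.NavierStokesRegularity.Theorems.TaoLadderRungTwoFlatCertificateGlueCheckerCoverOn
import Summits.NavierStokesRegularity.NavierStokesRegularity.Theorems.TaoLadderRungTwoFlatCertificateGlueLohnerVectorOn
import HarnessLib

/-!
# Certificate glue on a shift set `𝕊`, XXVII-c: THE STEP CHECKER IN THE VECTOR LAYOUT — `StepCert j` from the Boolean tests of one vector-remainder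
  mean-value Lohner step (glue XIX-h `stepCert_of_plohner_mv`): per-row frame radii, a remainder VECTOR, the frame enclosure over the node hull box,
  the product-form tube and cover test, and the weighted-box region tables (helper for items stmt-NavierStokesRegularity-22987 `FlatGapCertificatesV2`
  (crux K_A♭ of route TaoLadderRungTwoFlat) and stmt-24295 K_A₂(64); cell harvest/h2-tao-ladder, p1 g16; theory-1 A-73 / A-75)

`stepCert_of_checksV`: if the tests pass — (B)-table (C1, scalar guard/remainder), centre (C2), frame ROWS (C3v), hull radii, transport rows (C6v),
per-component E-recursion (C8v) against the COMPUTED `dPArr` (C4v), `kappaArr` (frame enclosure, glue XXV-j) and `nveArr` (remainder direction),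
guard (C9v), product-form cover (C13v, glue XXV-k), K-table, δ-table and Grönwall test on the weighted box (glue XXV-i) — then the step is a `StepCert j`
for the node predicates `PInParaV` (node `j` = input parallelepiped with remainder vector `E`, node `j+1` = output parallelepiped with `E'_c + A`) and
any hull containing the product tube fattened by `A·ω`.

HONEST FRAMING: Tao-type MODEL lattices (Tao 2016 §4/§6 vocabulary, shift-set parametrised); soundness of a checker — NO certificate instance exists
in the tree, nothing is certified here, no stub is closed, nothing here is a statement about the Navier–Stokes equations.
-/

-- the sub-problem namespace repeats the summit name by design (D-0017)
set_option linter.dupNamespace false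

namespace Summit.NavierStokesRegularity.NavierStokesRegularity.Theorems

open Set Finset Literature.Analysis.FluidPDE Literature.Analysis.FluidPDE.TaoCascade
open Summit.NavierStokesRegularity.NavierStokesRegularity.Theorems.TaylorModelCert
open Summit.NavierStokesRegularity.NavierStokesRegularity.Theorems.TaylorModelReadout

namespace CertificateGlueOn

variable {m : ℕ} {Kb Ka : ℤ}

/-- **THE VECTOR-LAYOUT STEP CHECKER IS SOUND** (see the module docstring for the list of tests; glue XIX-h with every analytic hypothesis
discharged by glue XXV-e, XXV-i, XXV-j, XXV-k).
[cite: Zgliczynski2002C1Lohner, §3–4 (Lohner-type parallelepiped frames and the C¹/variational enclosure); cell certificate format, Lohner step, vector remainder] -/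
theorem stepCert_of_checksV (hKb : 0 ≤ Kb) (hKa : 1 ≤ Ka) {shifts : List (ℤ × ℤ × ℤ)} (hnd : shifts.Nodup)
    (h𝕊 : IsNearestNeighbourSet shifts.toFinset) {q : ℚ} (hq : 0 < 1 + (q : ℝ))
    {αq : Fin m → Fin m → Fin m → ℤ × ℤ × ℤ → ℚ} {ωq : Fin m → ℤ → ℚ} (hω : ∀ i k, 0 < ωq i k)
    {prec p kexp nexp : ℕ} {Sp Sm : IntervalD} (hSp : sqrtCheck prec (1 + q) Sp = true)
    (hSm : sqrtCheck prec (1 / (1 + q)) Sm = true)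
    {M : ℤ → ℝ} {t : ℕ → ℝ} {Node Hull : ℕ → (Fin m → ℤ → ℝ) → Prop} {j : ℕ}
    {xD x'D rD r'D ρD ED E1D loD hiD : Array Dyad} {C Cn T : Array (Array Dyad)} {bD mC ρs δD : Dyad}
    {K A A' Eb Et h : ℚ}
    -- data signs and the step length
    (hb : 0 ≤ bD.toReal) (hmC : 0 ≤ mC.toReal) (hρs : 0 ≤ ρs.toReal) (hAA' : A < A') (ht : t (j + 1) - t j = (h : ℝ))
    -- the tests
    (hchkB : checkB m Kb Ka shifts (coefBoxOf prec αq ωq Sp Sm) bD = true)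
    (h2 : checkAbsLe (m * winLen Kb Ka) xD mC = true)
    (h3 : checkRowsLe (m * winLen Kb Ka) C rD ρD = true)
    (hhull : checkHull (m * winLen Kb Ka) ρD ED ρs = true)
    (h6 : checkRowsLe (m * winLen Kb Ka) T rD r'D = true)
    (h8 : checkERecV (m * winLen Kb Ka) p (dyadToRat bD) (dyadToRat mC) (dyadToRat ρs) h
      (dPArr (m * winLen Kb Ka) prec (IntervalD.polyLevelsA (m * winLen Kb Ka) prec
        (IntervalD.jetLevelsA (m * winLen Kb Ka) (pqBoxA Kb Ka prec shifts (coefBoxOf prec αq ωq Sp Sm)) prec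
          (pointBoxA (m * winLen Kb Ka) xD) p) p (ofRatRel prec h)) x'D)
      (kappaArr prec (m * winLen Kb Ka) Cn T
        (vcolsA Kb Ka prec shifts (coefBoxOf prec αq ωq Sp Sm) p
          (IntervalD.jetLevelsA (m * winLen Kb Ka) (pqBoxA Kb Ka prec shifts (coefBoxOf prec αq ωq Sp Sm)) prec
            (hullBoxA (m * winLen Kb Ka) xD ρD ED) p) (ofRatRel prec h) C) rD)
      (nveArr (m * winLen Kb Ka) (IntervalD.polyLevelsA (m * winLen Kb Ka) prec
        (IntervalD.varJetLevelsA (m * winLen Kb Ka) (pqBoxA Kb Ka prec shifts (coefBoxOf prec αq ωq Sp Sm)) prec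
          (IntervalD.jetLevelsA (m * winLen Kb Ka) (pqBoxA Kb Ka prec shifts (coefBoxOf prec αq ωq Sp Sm)) prec
            (hullBoxA (m * winLen Kb Ka) xD ρD ED) p) (symBoxA (m * winLen Kb Ka) ED) p) p (ofRatRel prec h)))
      E1D = true)
    (h9 : checkGuardV (dyadToRat bD) (dyadToRat mC) (dyadToRat ρs) h = true)
    -- the box-region tests
    (h13 : checkCoverV m Kb Ka shifts (coefBoxOf prec αq ωq Sp Sm) xD ρD ED loD hiD h A' = true)
    (h10 : checkLipT m Kb Ka shifts (coefBoxOf prec αq ωq Sp Sm) loD hiD K = true)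
    (h11 : checkDefectT m Kb Ka prec shifts αq ωq Eb Et loD hiD Sp Sm δD = true)
    (h12 : checkGronwallK K (dyadToRat δD) h A kexp nexp = true)
    -- the node / hull inclusions (definitional for the chain builder)
    (hN : ∀ y, Node j y → PInParaV Kb Ka (fun i k => (ωq i k : ℝ)) (dvec (n := m * winLen Kb Ka) xD)
      (dmat (n := m * winLen Kb Ka) C) (dvec (n := m * winLen Kb Ka) rD) (dvec (n := m * winLen Kb Ka) ED) y)
    (hH : ∀ u ∈ Icc 0 (h : ℝ), ∀ y q' : Fin m → ℤ → ℝ,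
      ProdTube Kb Ka (fun i k => (ωq i k : ℝ)) (dvec (n := m * winLen Kb Ka) xD) (dvec (n := m * winLen Kb Ka) ρD)
        (dvec (n := m * winLen Kb Ka) ED) (vOf Kb Ka shifts (coefBoxOf prec αq ωq Sp Sm) loD hiD) u q' →
      (∀ i k, -Kb ≤ k → k ≤ Ka → |y i k - q' i k| ≤ (A : ℝ) * (ωq i k : ℝ)) → Hull j y)
    (hN' : ∀ y, PInParaV Kb Ka (fun i k => (ωq i k : ℝ)) (dvec (n := m * winLen Kb Ka) x'D)
      (dmat (n := m * winLen Kb Ka) Cn) (dvec (n := m * winLen Kb Ka) r'D) (fun c => dvec (n := m * winLen Kb Ka) E1D c + (A : ℝ)) y →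
      Node (j + 1) y) :
    StepCert shifts.toFinset (q : ℝ) (fun i₁ i₂ i μ => (αq i₁ i₂ i μ : ℝ)) Kb Ka (Eb : ℝ) (Et : ℝ) M t Node Hull j := by
  have hcoef := coefBoxOK_coefBoxOf (Kb := Kb) (Ka := Ka) prec hq αq ωq hSp hSm shifts
  have hω' : ∀ i k, (0 : ℝ) < (ωq i k : ℝ) := fun i k => by exact_mod_cast hω i k
  have hKK : 0 ≤ Ka + Kb + 1 := by omega
  have hX : (pointBoxA (m * winLen Kb Ka) xD).size = m * winLen Kb Ka := by simp [pointBoxA]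
  have hx := mem_pointBoxA (m * winLen Kb Ka) xD
  have hhmem : IntervalD.mem (t (j + 1) - t j) (ofRatRel prec h) := by rw [ht]; exact mem_ofRatRel prec h
  -- scalar tests, casts bridged
  have hg := guardV_of_check h9
  have hgr := gronwallK_of_check h12
  have hKδ := nonneg_of_checkGronwallK h12
  have hE := eRecV_of_check h8
  simp only [cast_dyadToRat] at hg hgr hKδ hE
  have hAA'r : (A : ℝ) < (A' : ℝ) := by exact_mod_cast hAA'
  -- `0 < A'` from `0 ≤ gronwallBound ≤ A < A'`
  have hA0 : (0 : ℝ) ≤ (A : ℝ) := (gronwallBound_nonneg_of_zero hKδ.2 hg.1).trans hgr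
  have hA' : 0 < A' := by
    have : (0 : ℝ) < (A' : ℝ) := hA0.trans_lt hAA'r
    exact_mod_cast this
  refine stepCert_of_plohner_mv (ω := fun i k => (ωq i k : ℝ)) (p := p) hKb hKa hq hω' hb hmC hρs hKδ.1 hKδ.2 hAA'r
    (by rw [ht]; exact hg.1) (by rw [ht]; exact hg.2) (hB_of_checkB hKb hKa hω' hq hnd hcoef hchkB)
    (abs_le_of_checkAbsLe h2) (mulVec_le_of_checkRowsLe h3) (hull_le_of_checkHull hhull)
    (abs_TPoly_sub_le_dPArr hKb hKa hnd hcoef p hX hx hhmem x'D)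
    (kappa_of_kappaArr hKb hKa hnd hcoef p xD ρD ED hhmem C Cn T rD)
    (abs_VPoly_le_nveArr hKb hKa hnd hcoef p xD ρD ED hhmem)
    (mulVec_le_of_checkRowsLe h6) (fun c => by rw [ht]; exact hE c)
    (pqcN_prod_bound hKb hKa hω' hq hnd hcoef loD hiD)
    (fun c => vRowSum_nonneg hnd loD hiD _ _)
    (fun c => by rw [ht]; exact hG_of_checkCoverV hnd hA' h13 hKK c)
    (fun u hu q' y hq' hnear => inBox_of_checkCoverV hnd hω h13 (by rwa [ht] at hu) hq' hnear)
    (pfieldLip_of_checkLipT hKb hKa hω' hq hcoef h10)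
    (pinputDefect_of_checkDefectT prec hnd h𝕊 hq hω hSp hSm h11) (by rw [ht]; exact hgr) hN
    (fun u hu y q' hq' hnear => hH u (by rwa [ht] at hu) y q' hq' hnear) hN'

end CertificateGlueOn

end Summit.NavierStokesRegularity.NavierStokesRegularity.Theorems
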